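import Mathlib
import Summits.ValiantsHypothesis.ValiantsHypothesis.Theorems.LacunarySymmetroidMatrixDescartesStubArith4

/-!
# Crux `MatrixDescartes` (stmt-ValiantsHypothesis-18050), line `Lift` — registered stub `stub_shadowArith`

Regime arithmetic of the tropical door.  A design in the regime `m ≤ 2^((⌊log₂ K⌋ + c₀)^c₀)`
with `B` breakpoints, `2^(K ⌊log₂ K⌋) < B^q`, is embedded into the permutation matrices on
`n = m (K + 2)` nodes; this stub shows that `B + 1` then beats every quasi-polynomial
`2^((⌊log₂ n⌋ + c)^c)` once `K ≥ K₁(c₀, q, c)`: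

`∃ K₁, ∀ K m B, K₁ ≤ K → m ≤ 2 ^ ((Nat.log 2 K + c₀) ^ c₀) → 2 ^ (K * Nat.log 2 K) < B ^ q →
  2 ^ ((Nat.log 2 (m * (K + 2)) + c) ^ c) < B + 1`.

Proof.  Put `L := ⌊log₂ K⌋`, `A := (L + c₀)^c₀`, `E := (⌊log₂ (m (K+2))⌋ + c)^c`.  From `m ≤ 2^A`
and `K + 2 < 2^(L+2)` we get `m (K + 2) < 2^(A + L + 2)`, so
`⌊log₂ (m (K+2))⌋ + c ≤ A + L + c + 1 ≤ x^c₀ + x ≤ x^(c₀+2)` with `x := L + (c₀ + c + 2) ≥ 2`,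
whence `E ≤ x^((c₀+2) c)`.  Polynomial versus exponential (`StubShadowArith.poly_le_two_pow`,
proved from the binomial bound `n^(e+1) ≤ (e+1)! · 2^(n+e)` of the sibling stub file
`…StubArith4`, no analysis) gives
`q · x^((c₀+2) c) ≤ 2^L ≤ K ≤ K L` for all `L ≥ L₁ + 1`, i.e. for all `K ≥ K₁ := 2^(L₁+1)`.
Hence `(2^E)^q = 2^(q E) ≤ 2^(K L) < B^q`, so `2^E < B < B + 1` (no hypothesis `0 < q` is
needed: for `q = 0` the hypothesis `2^(K L) < B^0` is absurd).

Elementary; Mathlib and the landed sibling stub `StubArith4` only (axioms `propext`,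
`Classical.choice`, `Quot.sound`).
-/

-- layout Summits/ValiantsHypothesis/ValiantsHypothesis forces the duplicated namespace component
set_option linter.dupNamespace false

namespace Summit.ValiantsHypothesis.ValiantsHypothesis.Theorems.LacunarySymmetroidMatrixDescartes

namespace StubShadowArith

-- `poly_le_two_pow` is `StubArith4.poly_le_two_pow` (imported sibling stub file) with shift and
-- exponent decoupled, on top of the imported binomial bound
-- `StubArith4.pow_succ_le_factorial_mul_two_pow`; `pow_add_self_le` and the `log₂` bookkeeping are
-- adapted from Cruxes/MatrixDescartes/StrategySketch.lean (strategist)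

/-- Polynomial versus exponential, in `ℕ`: for all `s e q` there is `L₁` with
`q (L + s)^e ≤ 2^L` for all `L ≥ L₁` (one admissible threshold: `L₁ = q (e+1)! 2^(s+e)`). -/
theorem poly_le_two_pow (s e q : ℕ) : ∃ L₁ : ℕ, ∀ L : ℕ, L₁ ≤ L → q * (L + s) ^ e ≤ 2 ^ L := by
  set M := (e + 1).factorial * 2 ^ (s + e) with hM
  have hMpos : 0 < M := by positivity
  refine ⟨q * M, fun L hL => ?_⟩
  have hA := StubArith4.pow_succ_le_factorial_mul_two_pow (L + s) e
  have key : M * (q * (L + s) ^ e) ≤ M * 2 ^ L :=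
    calc M * (q * (L + s) ^ e) = (q * M) * (L + s) ^ e := by ring
      _ ≤ (L + s) * (L + s) ^ e := Nat.mul_le_mul_right _ (by omega)
      _ = (L + s) ^ (e + 1) := (pow_succ' _ _).symm
      _ ≤ (e + 1).factorial * 2 ^ (L + s + e) := hA
      _ = M * 2 ^ L := by rw [hM]; ring
  exact Nat.le_of_mul_le_mul_left key hMpos

/-- `x^a + x ≤ x^(a+2)` for `x ≥ 2`. -/
theorem pow_add_self_le (x a : ℕ) (hx : 2 ≤ x) : x ^ a + x ≤ x ^ (a + 2) := by
  have h1 : 1 ≤ x ^ a := Nat.one_le_pow _ _ (by omega)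
  have h2 : x ^ (a + 2) = x ^ a * (x * x) := by ring
  have h5 : x ^ a * x + x ^ a * x ≤ x ^ a * (x * x) := by
    have h6 : x ^ a * x + x ^ a * x = x ^ a * (2 * x) := by ring
    rw [h6]
    exact Nat.mul_le_mul_left _ (by nlinarith)
  have h3 : x ^ a ≤ x ^ a * x := Nat.le_mul_of_pos_right _ (by omega)
  have h4 : x ≤ x ^ a * x := Nat.le_mul_of_pos_left _ h1
  rw [h2]
  omega

/-- The logarithm of the node count: in the regime `m ≤ 2^((⌊log₂ K⌋ + c₀)^c₀)`,
`⌊log₂ (m (K+2))⌋ + c ≤ x^(c₀+2)` with `x = ⌊log₂ K⌋ + (c₀ + c + 2)`. -/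
theorem log_nodes_le (c₀ c K m : ℕ) (hm : m ≤ 2 ^ ((Nat.log 2 K + c₀) ^ c₀)) :
    Nat.log 2 (m * (K + 2)) + c ≤ (Nat.log 2 K + (c₀ + c + 2)) ^ (c₀ + 2) := by
  set L := Nat.log 2 K with hL
  set A := (L + c₀) ^ c₀ with hA
  have hKlt : K < 2 ^ (L + 1) := Nat.lt_pow_succ_log_self one_lt_two K
  have h2 : 2 ≤ 2 ^ (L + 1) :=
    calc (2 : ℕ) = 2 ^ 1 := (pow_one 2).symm
      _ ≤ 2 ^ (L + 1) := Nat.pow_le_pow_right (by norm_num) (by omega)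
  have hK2 : K + 2 < 2 ^ (L + 2) :=
    calc K + 2 < 2 ^ (L + 1) + 2 ^ (L + 1) := by omega
      _ = 2 ^ (L + 2) := by ring
  have hprod : m * (K + 2) < 2 ^ (A + L + 2) :=
    calc m * (K + 2) ≤ 2 ^ A * (K + 2) := Nat.mul_le_mul_right _ hm
      _ < 2 ^ A * 2 ^ (L + 2) := Nat.mul_lt_mul_of_pos_left hK2 (by positivity)
      _ = 2 ^ (A + L + 2) := by ring
  have hlog : Nat.log 2 (m * (K + 2)) < A + L + 2 := Nat.log_lt_of_lt_pow' (by omega) hprod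
  set x := L + (c₀ + c + 2) with hx
  have hx2 : 2 ≤ x := by omega
  have hAx : A ≤ x ^ c₀ := by
    rw [hA]
    exact Nat.pow_le_pow_left (by omega) c₀
  calc Nat.log 2 (m * (K + 2)) + c ≤ A + L + c + 1 := by omega
    _ ≤ x ^ c₀ + x := by omega
    _ ≤ x ^ (c₀ + 2) := pow_add_self_le x c₀ hx2

/-- The exponent comparison: for `K ≥ K₁(c₀, q, c)`, in the regime
`m ≤ 2^((⌊log₂ K⌋ + c₀)^c₀)`, one has `q (⌊log₂ (m (K+2))⌋ + c)^c ≤ K ⌊log₂ K⌋`. -/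
theorem exp_le (c₀ q c : ℕ) : ∃ K₁ : ℕ, ∀ K m : ℕ, K₁ ≤ K →
    m ≤ 2 ^ ((Nat.log 2 K + c₀) ^ c₀) →
    q * (Nat.log 2 (m * (K + 2)) + c) ^ c ≤ K * Nat.log 2 K := by
  obtain ⟨L₁, hL₁⟩ := poly_le_two_pow (c₀ + c + 2) ((c₀ + 2) * c) q
  refine ⟨2 ^ (L₁ + 1), fun K m hK hm => ?_⟩
  have hK0 : K ≠ 0 := by
    have := Nat.one_le_two_pow (n := L₁ + 1)
    omega
  have hL : L₁ + 1 ≤ Nat.log 2 K := Nat.le_log_of_pow_le one_lt_two hK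
  have h2L : 2 ^ Nat.log 2 K ≤ K := Nat.pow_log_le_self 2 hK0
  have hE : (Nat.log 2 (m * (K + 2)) + c) ^ c ≤
      (Nat.log 2 K + (c₀ + c + 2)) ^ ((c₀ + 2) * c) :=
    calc (Nat.log 2 (m * (K + 2)) + c) ^ c
        ≤ ((Nat.log 2 K + (c₀ + c + 2)) ^ (c₀ + 2)) ^ c :=
          Nat.pow_le_pow_left (log_nodes_le c₀ c K m hm) c
      _ = (Nat.log 2 K + (c₀ + c + 2)) ^ ((c₀ + 2) * c) := (pow_mul _ _ _).symm
  calc q * (Nat.log 2 (m * (K + 2)) + c) ^ c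
      ≤ q * (Nat.log 2 K + (c₀ + c + 2)) ^ ((c₀ + 2) * c) := Nat.mul_le_mul_left _ hE
    _ ≤ 2 ^ Nat.log 2 K := hL₁ _ (by omega)
    _ ≤ K := h2L
    _ = K * 1 := (mul_one K).symm
    _ ≤ K * Nat.log 2 K := Nat.mul_le_mul_left K (by omega)

end StubShadowArith

/-- **Registered stub `stub_shadowArith`** (regime arithmetic of the tropical door): in the regime
`m ≤ 2^((⌊log₂ K⌋ + c₀)^c₀)`, a breakpoint count with `B^q > 2^(K ⌊log₂ K⌋)` beats every
quasi-polynomial `2^((⌊log₂ n⌋ + c)^c)` in the node count `n = m (K + 2)` of the embedding, for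
all `K ≥ K₁(c₀, q, c)`. -/
theorem stub_shadowArith (c₀ q c : ℕ) : ∃ K₁ : ℕ, ∀ K m B : ℕ, K₁ ≤ K →
    m ≤ 2 ^ ((Nat.log 2 K + c₀) ^ c₀) → 2 ^ (K * Nat.log 2 K) < B ^ q →
    2 ^ ((Nat.log 2 (m * (K + 2)) + c) ^ c) < B + 1 := by
  obtain ⟨K₁, hK₁⟩ := StubShadowArith.exp_le c₀ q c
  refine ⟨K₁, fun K m B hK hm hB => ?_⟩
  have hpow : (2 ^ ((Nat.log 2 (m * (K + 2)) + c) ^ c)) ^ q < B ^ q :=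
    calc (2 ^ ((Nat.log 2 (m * (K + 2)) + c) ^ c)) ^ q
        = 2 ^ (q * (Nat.log 2 (m * (K + 2)) + c) ^ c) := (pow_mul' 2 q _).symm
      _ ≤ 2 ^ (K * Nat.log 2 K) := Nat.pow_le_pow_right (by norm_num) (hK₁ K m hK hm)
      _ < B ^ q := hB
  exact Nat.lt_succ_of_lt (lt_of_pow_lt_pow_left₀ q (Nat.zero_le B) hpow)

end Summit.ValiantsHypothesis.ValiantsHypothesis.Theorems.LacunarySymmetroidMatrixDescartes
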